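import Summits.CriticalPhenomena.PercolationContinuityZ3.Theorems.PercNearOneGluingAdditiveGluingSetObserverPreMarginApprox
import Summits.CriticalPhenomena.PercolationContinuityZ3.Theorems.PercNearOneGluingAdditiveGluingSetObserverSurplusApprox
import HarnessLib

/-!
# Conjecture G / SET-W via a SET observer, XXIII: the glued gap of the stub from CSH-set, ROBUST in the minimality of the designated relay

Support file (`--supports stmt-CriticalPhenomena-4576`); no definitions, no named facts, no sorries.  Seat (b) V⁺-form `png-dp-vplus`, gen 13
(memo MEMO-gen13.md §3).  Robust copies of gen 12's `CSHSet.setTwoObs_of_cshSet` / `CSHSet.fingerML3_of_cshSet` (`…SetObserverAssembly.lean`):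
* `CSHSet.setTwoObs_of_cshSet_approx` — the set two-observer margin with a `δ`-approximate argmin, from the robust Theorem 2-set
  `CSHSet.preMarginSet_ge_of_cshSet_approx` at `D = []`: `E·Δ_k ≤ M·Δ_O + M·δ·|X'|·2^{|X'|}`;
* **`CSHSet.fingerML3_gap_of_cshSet_approx`** — for weights `< 1` and `τ(d) ≤ τ(a) + δ` on `A`: the glued gap of `stub_fingerML3_vp` is
  `≥ −δ·|A|·2^{|A|}` (via `SetSurplus.fingerML3_gap_of_twoObs_approx`).  With Theorem 1-set (`CSHSet.cshSetAll`) this feeds the weight-`1`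
  closure of the stub.
[cite: KozmaNitzan2024, Thm 4 (pp. 12–14), Conj. 4 (p. 32)] [cite: VandenbergHaggstromKahn2005, §2.1 (pp. 9–13), Thm. 2.1 (p. 9)]
-/

noncomputable section

namespace Summit.CriticalPhenomena.PercolationContinuityZ3.Theorems

open MeasureTheory Set Literature.Probability.LatticeModels Literature.Probability.Percolation
open scoped Classical

namespace CSHSet

open KNPreFKG CSH SetSurplus

variable {n : ℕ}

/-- **The approximate set two-observer margin from CSH-set** (robust copy of `setTwoObs_of_cshSet`: `c` a `δ`-argmin in `X'`).
[cite: KozmaNitzan2024, Conj. 4 (p. 32)] -/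
theorem setTwoObs_of_cshSet_approx (w : Sym2 (Fin n) → unitInterval) (hw : ∀ e, w e < 1) (O : Finset (Fin n)) (δ : ℝ) (hδ : 0 ≤ δ)
    (hCSH : ∀ (v x : Fin n) (Y : Finset (Fin n)) (D : List (Fin n)),
      x ∉ Y → v ≠ x → v ∉ Y → D.Nodup → (∀ d ∈ D, d ≠ x ∧ d ∉ Y ∧ d ≠ v) →
      (∀ o ∈ O, o ≠ x ∧ o ∉ Y ∧ o ≠ v ∧ o ∉ D) → CSHSetHolds w x (↑Y : Set (Fin n)) D O v)
    (r : Fin n → ℕ) (F : Set (Fin n) → ℝ) (hF : ∀ S S' : Set (Fin n), S ⊆ S' → F S ≤ F S') (c : Fin n)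
    (X' : Finset (Fin n)) (k : Fin n) (hcX' : c ∈ X') (hkX' : k ∉ X')
    (hcmin : ∀ a ∈ X', ∫ ω, F (openCluster ω c) ∂(prodBernoulli w) ≤ (∫ ω, F (openCluster ω a) ∂(prodBernoulli w)) + δ)
    (hrc : ∀ a ∈ X', a ≠ c → r c < r a) (hr : Set.InjOn r ↑X') (hOX : ∀ o ∈ O, o ∉ X' ∧ o ≠ k) :
    (prodBernoulli w).real ({ω : BondConfig (Fin n) | ∃ o ∈ O, (openGraph ω).Reachable o k} ∩
        {ω | ∀ o ∈ O, ∀ a ∈ X', ¬ (openGraph ω).Reachable o a}) *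
      (∫ ω in ⋃ a ∈ X', openConn k a, (F (openCluster ω k) - F (openCluster ω c)) ∂(prodBernoulli w)) ≤
    (prodBernoulli w).real {ω : BondConfig (Fin n) | ∀ a ∈ (↑X' : Set (Fin n)), ¬ (openGraph ω).Reachable k a} *
      ∑ a ∈ X', ∫ ω in {ω : BondConfig (Fin n) | ∃ o ∈ O, (openGraph ω).Reachable o a} ∩
        {ω | ∀ a' ∈ X', r a' < r a → ∀ o ∈ O, ¬ (openGraph ω).Reachable o a'},
        (F (openCluster ω a) - F (openCluster ω c)) ∂(prodBernoulli w) +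
    (prodBernoulli w).real {ω : BondConfig (Fin n) | ∀ a ∈ (↑X' : Set (Fin n)), ¬ (openGraph ω).Reachable k a} *
      (δ * (X'.card : ℝ) * 2 ^ X'.card) := by
  have h := preMarginSet_ge_of_cshSet_approx w hw O k r δ hδ (fun x Y D hxY hkx hkY hD hDX hO => hCSH k x Y D hxY hkx hkY hD hDX hO)
    X' c [] F hF hcX' hcmin hrc hr hkX' List.nodup_nil (fun d hd => by simp at hd)
    (fun o ho => ⟨(hOX o ho).1, (hOX o ho).2, by simp⟩)
  simp only [List.length_nil, add_zero] at h
  simp only [decoyListSet_nil, cshMarg_nil, preSurplusSet_none, preSurplusSet_some] at h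
  -- identify the constant `obsConstSet w O k (↑X' ∪ ∅) = E/M`
  set Dk : Set (BondConfig (Fin n)) := {ω : BondConfig (Fin n) | ∀ a ∈ (↑X' : Set (Fin n)), ¬ (openGraph ω).Reachable k a} with hDk
  set EO : Set (BondConfig (Fin n)) := {ω : BondConfig (Fin n) | ∃ o ∈ O, (openGraph ω).Reachable o k} ∩
    {ω | ∀ o ∈ O, ∀ a ∈ X', ¬ (openGraph ω).Reachable o a} with hEO
  set SO : ℝ := ∑ a ∈ X', ∫ ω in {ω : BondConfig (Fin n) | ∃ o ∈ O, (openGraph ω).Reachable o a} ∩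
        {ω | ∀ a' ∈ X', r a' < r a → ∀ o ∈ O, ¬ (openGraph ω).Reachable o a'},
        (F (openCluster ω a) - F (openCluster ω c)) ∂(prodBernoulli w) with hSO
  set Sk : ℝ := ∫ ω in ⋃ a ∈ X', openConn k a, (F (openCluster ω k) - F (openCluster ω c)) ∂(prodBernoulli w) with hSk
  have hset0 : ((↑X' : Set (Fin n)) ∪ {d | d ∈ ([] : List (Fin n))}) = ↑X' := by simp
  have hp0 : obsConstSet w O k ((↑X' : Set (Fin n)) ∪ {d | d ∈ ([] : List (Fin n))}) =
      (prodBernoulli w).real EO / (prodBernoulli w).real Dk := by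
    rw [hset0, obsConstSet, obsEv, hEO, hDk]
    simp only [Finset.mem_coe]
  rw [hp0] at h
  have hempty : (∅ : BondConfig (Fin n)) ∈ Dk := by
    intro a ha h'
    rw [HullPort.reachable_empty_iff] at h'
    exact hkX' (h' ▸ (Finset.mem_coe.1 ha))
  have hMpos : 0 < (prodBernoulli w).real Dk := prodBernoulli_real_pos_of_empty_mem w hw hempty
  have h2 : (prodBernoulli w).real Dk * (-(δ * (X'.card : ℝ) * 2 ^ X'.card)) ≤
      (prodBernoulli w).real Dk * (SO - (prodBernoulli w).real EO / (prodBernoulli w).real Dk * Sk) :=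
    mul_le_mul_of_nonneg_left h hMpos.le
  have e : (prodBernoulli w).real Dk * (SO - (prodBernoulli w).real EO / (prodBernoulli w).real Dk * Sk) =
      (prodBernoulli w).real Dk * SO - (prodBernoulli w).real EO * Sk := by
    field_simp
  linarith [h2, e]

/-- **The glued gap of the V⁺ stub from CSH-set, robust in the minimality of `d`** (weights `< 1`): `gap ≥ −δ·|A|·2^{|A|}`.
[cite: KozmaNitzan2024, Thm 4 (pp. 12–14), Conj. 4 (p. 32)] [cite: VandenbergHaggstromKahn2005, Thm. 2.1 (p. 9)] -/
theorem fingerML3_gap_of_cshSet_approx (K : Sym2 (Fin n) → unitInterval) (hK : ∀ e, K e < 1) (A N : Finset (Fin n)) (d b : Fin n) (hbA : b ∈ A)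
    (hNA : Disjoint N A) (hdA : d ∈ A) (hfree : ∀ v ∈ N, ∀ y : Fin n, y ∉ A → y ∉ N → (K s(v, y) : ℝ) = 0) (δ : ℝ) (hδ : 0 ≤ δ)
    (hmin : ∀ a ∈ A, (prodBernoulli K).real (openConn d b) ≤ (prodBernoulli K).real (openConn a b) + δ)
    (hCSH : ∀ (v x : Fin n) (Y : Finset (Fin n)) (D : List (Fin n)),
      x ∉ Y → v ≠ x → v ∉ Y → D.Nodup → (∀ d' ∈ D, d' ≠ x ∧ d' ∉ Y ∧ d' ≠ v) →
      (∀ o ∈ N, o ≠ x ∧ o ∉ Y ∧ o ≠ v ∧ o ∉ D) → CSHSetHolds K x (↑Y : Set (Fin n)) D N v) :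
    -(δ * (A.card : ℝ) * 2 ^ A.card) ≤
      (prodBernoulli (fun e' : Sym2 (Fin n) => if (∀ y ∈ e', y ∈ N) ∧ ¬ e'.IsDiag then 1 else K e')).real
          ({ω : Set (Sym2 (Fin n)) | ∃ v ∈ N, ∃ a ∈ A, s(v, a) ∈ ω} ∩ ⋃ v ∈ N, openConn v b) -
        (prodBernoulli (fun e' : Sym2 (Fin n) => if (∀ y ∈ e', y ∈ N) ∧ ¬ e'.IsDiag then 1 else K e')).real
          ({ω : Set (Sym2 (Fin n)) | ∃ v ∈ N, ∃ a ∈ A, s(v, a) ∈ ω} ∩ openConn d b) := by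
  refine fingerML3_gap_of_twoObs_approx K A N d b hbA hNA hdA hfree δ hδ hmin fun r X' k hX'A hkA hdX' hkX' hcmin hrk hinj => ?_
  have hF : ∀ S S' : Set (Fin n), S ⊆ S' → (fun S : Set (Fin n) => if b ∈ S then (1 : ℝ) else 0) S ≤
      (fun S : Set (Fin n) => if b ∈ S then (1 : ℝ) else 0) S' := by
    intro S S' hSS'
    by_cases hS : b ∈ S
    · simp only [if_pos hS, if_pos (hSS' hS), le_refl]
    · simp only [if_neg hS]; split_ifs <;> norm_num
  exact setTwoObs_of_cshSet_approx K hK N δ hδ hCSH r _ hF d X' k hdX' hkX' hcmin hrk hinj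
    (fun o ho => ⟨fun h => Finset.disjoint_left.1 hNA ho (hX'A h), fun h => Finset.disjoint_left.1 hNA ho (h ▸ hkA)⟩)

end CSHSet

end Summit.CriticalPhenomena.PercolationContinuityZ3.Theorems

end
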